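import Summits.QuantumFields.QCD.Theses.EulerDescent
import Literature.MathematicalPhysics.QuantumFieldTheory.QCDAsymptoticScalingCouplingDivergence

/-!
# Crux `EulerDescent.HonestHeavyAnchor` (stmt-QuantumFields-16901), line `bounded_locator` rev 3, stub
# `stub_nonMassiveBelowOfBody` (R, the NON-MASSIVE POINT BELOW): the SIGN-FLIP LOCATOR certificate

Worker file (def-free, sorry-free) for the registered stub `stub_nonMassiveBelowOfBody` (R) of
`Cruxes/HonestHeavyAnchor/Lines/bounded_locator.lean`: for `N_f ∈ {2,3}`, every mass-scaling, asymptotically scaling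
regularisation `reg` carrying the heavy body above `M` admits `C` such that, eventually in `k`, SOME degenerate bare
Wilson mass `μ ≥ m_crit(k) − a_k C/Z_m(k)` is NON-massive at `β_k`.  The stub is open-problem grade and is NOT proved
here.  This file is the ORDER/TOPOLOGY half of the crux-ideation card `Cruxes/HonestHeavyAnchor/Ideas/pcac-sign-flip.md`,
with ALL of its physics left as hypotheses:

* the card's fixed-coupling lemma `PCACSignFlipLocator` is taken with its two PCAC-sign predicates ABSTRACTED to arbitrary
  `P Q : ℝ → ℝ → Prop` (read `P β μ` := "at coupling `β` and degenerate bare mass `μ` the finite-torus PCAC ratio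
  `⟨Δ₄A₄^T(n e₀) P^T(0)⟩^conn/⟨P^T(n e₀) P^T(0)⟩^conn` is eventually NEGATIVE", `Q β μ` := "… eventually POSITIVE"):
  `∀ β ≥ β₀, ∀ μ₁ < μ₂` on the branch `−1 < μ₁`, `P β μ₁ → Q β μ₂ → [μ₁, μ₂]` meets the CLOSURE of the non-massive set
  at `β` (a flavour-symmetric massive region with negative and one with positive PCAC mass are not analytically connected
  along the Wilson axis: the connecting point is an Aoki edge with a massless pion or a first-order coexistence point,
  both non-massive — [cite: SharpeSingleton1998, §4], [cite: Aoki1984WilsonPhase],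
  [cite: MontvayMunster1994, §5.3.2 (5.167)–(5.177)] for the lattice PCAC relation and the critical line `m₀ = m̄`);
* the two eventual signs at the construction's OWN heavy points `μ₁(k) = m_crit(k) − a_k C/Z_m(k)` (RGI mass `−C`,
  sign `−`) and `μ₂(k) = m_crit(k) + a_k M/Z_m(k)` (RGI mass `+M`, sign `+`), and the branch condition `−1 < μ₁(k)`.

What is PROVED (pure order/filter bookkeeping over `QCDOS.lean`, standard axioms, no `def` — the non-massive set is
written out verbatim so that R's registered conclusion matches by shape):

* §1 `exists_mem_gt_of_mem_closure` / `exists_nonMassive_gt_of_mem_closure`: a point of the closure of a set of reals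
  (resp. of the non-massive set at `β`) has genuine members above `μ⋆ − ε` for every `ε > 0` (`Metric.mem_closure_iff`);
* §2 `ray_below_lt_ray_above` (`−C < M ⇒ μ₁(k) < μ₂(k)`, by `a_k, Z_m(k) > 0`) and `ray_below_succ`
  (`m_crit − a(C+1)/Z_m = μ₁ − a/Z_m`);
* §3 `nonMassive_below_of_signFlipLocator_or_self` and `nonMassive_below_of_signFlipLocator` (ONE regularisation): the
  abstract locator at `β ≥ β₀`, `β_k → +∞`, the branch, `−C < M`, and eventually [`μ₁(k)` non-massive OR `P(β_k, μ₁(k))`]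
  (resp. eventually `P(β_k, μ₁(k))`) and `Q(β_k, μ₂(k))` give R's conclusion for `reg` with constant `C + 1`: the closure
  point `μ⋆ ≥ μ₁(k)` has a genuine non-massive mass above `μ⋆ − a_k/Z_m(k) ≥ m_crit(k) − a_k(C+1)/Z_m(k)`.  The
  disjunctive form is the card's `N_f = 3` dichotomy at the `θ_eff = π` point `μ₁(k)`: EITHER it is non-massive (then it
  is itself the witness) OR it is massive and its PCAC sign is UV-dominated, hence `−`;
* §4 `stub_nonMassiveBelowOfBody_of_signFlipFamily_or_self` and `stub_nonMassiveBelowOfBody_of_signFlipFamily`: the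
  registered statement of R VERBATIM from "for each `N_f ∈ {2,3}` some predicates `P, Q` and `β₀` satisfy the locator, and
  every body-carrying regularisation has constants `C`, `M₂` with the branch, `−C < M₂` and the two eventual signs"
  (`β_k → +∞` from asymptotic scaling, `QCDRegularisation.tendsto_beta_atTop_of_hasAsymptoticScaling`, `N_f ≤ 16`).

Not duplicated from `EulerDescentHonestHeavyAnchorNonMassiveBelow.lean` (R ⟺ S4' given the corner, R ⟸ mirror
long-range order at θ = π, R ⟸ corner ∧ separated lattice decoupling, the flavour split 2/3).  Presearch (2026-08-17,
corpus): `lit search --hybrid` "PCAC quark mass sign change Wilson fermions Aoki phase first order transition" → top hit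
MontvayMunster1994 pp. 297–298 (finite-temperature chiral transition, numerics/EFT, no theorem); `lit vsearch` "between
negative and positive PCAC quark mass …" → Greensite2011 p. 127 & textbooks, no theorem; `lit galaxy search` (Sharpe–
Singleton / Aoki phase) → 0 relevant rows; "CP violation theta equals pi spontaneous breaking lattice proof" → Dine2022,
Branco1999, BietenholzWiese2025 (expositions).  No printed RIGOROUS theorem supplies a non-massive bare Wilson mass near
the critical line at weak coupling; the locator and the sign data stay hypotheses.
-/

namespace Summit.QuantumFields.QCD.Theorems.HonestHeavyAnchorNonMassiveBelowSignFlip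

open Filter Topology
open Literature.MathematicalPhysics.QuantumFieldTheory

variable {Nf : ℕ}

/-! ## §1 Closure points have genuine members just below them -/

/-- A point `x` of the closure of `s ⊆ ℝ` has, for every `ε > 0`, a member of `s` above `x − ε`
(`Metric.mem_closure_iff`, `Real.dist_eq`). [folklore] -/
theorem exists_mem_gt_of_mem_closure (s : Set ℝ) (x : ℝ) (hx : x ∈ closure s) (ε : ℝ) (hε : 0 < ε) :
    ∃ y ∈ s, x - ε < y := by
  obtain ⟨y, hy, hxy⟩ := Metric.mem_closure_iff.1 hx ε hε
  refine ⟨y, hy, ?_⟩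
  rw [Real.dist_eq] at hxy
  linarith [(abs_sub_lt_iff.1 hxy).1]

/-- **(a)** If `μ⋆` lies in the CLOSURE of the non-massive degenerate bare masses at coupling `β` (those `μ` at which
NOT every pair of gauge-invariant local observables clusters exponentially, uniformly on large odd tori), then for every
`ε > 0` some genuinely non-massive `μ > μ⋆ − ε` exists. [folklore] -/
theorem exists_nonMassive_gt_of_mem_closure :
    ∀ (Nf : ℕ) (β μs : ℝ),
      μs ∈ closure {μ : ℝ | ¬ (∀ (R R' : ℕ) (A : QCDLatticeObservable Nf R) (B : QCDLatticeObservable Nf R'),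
        ∃ (C δ : ℝ) (S₀ : ℕ), 0 < δ ∧ ∀ S : ℕ, S₀ ≤ S → ∀ n : ℕ, n ≤ S →
          ‖qcdLatticeConnectedCorr β (2 * S + 1) (fun _ : Fin Nf => μ) A B n‖ ≤ C * Real.exp (-(δ * n)))} →
      ∀ ε : ℝ, 0 < ε → ∃ μ : ℝ, μs - ε < μ ∧
        ¬ (∀ (R R' : ℕ) (A : QCDLatticeObservable Nf R) (B : QCDLatticeObservable Nf R'), ∃ (C δ : ℝ) (S₀ : ℕ),
          0 < δ ∧ ∀ S : ℕ, S₀ ≤ S → ∀ n : ℕ, n ≤ S →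
            ‖qcdLatticeConnectedCorr β (2 * S + 1) (fun _ : Fin Nf => μ) A B n‖ ≤ C * Real.exp (-(δ * n))) := by
  intro Nf β μs hμs ε hε
  obtain ⟨μ, hμN, hμgt⟩ := exists_mem_gt_of_mem_closure _ μs hμs ε hε
  exact ⟨μ, hμgt, hμN⟩

/-! ## §2 The two heavy points are ordered; one RGI step below the lower one -/

/-- `−C < M ⇒ m_crit(k) − a_k C/Z_m(k) < m_crit(k) + a_k M/Z_m(k)` (`a_k, Z_m(k) > 0`): the negative heavy point lies
strictly below the positive one. [folklore] -/
theorem ray_below_lt_ray_above (reg : QCDRegularisation Nf) (C M : ℝ) (hCM : -C < M) (k : ℕ) :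
    reg.mcrit k - reg.a k * C / reg.Zm k < reg.mcrit k + reg.a k * M / reg.Zm k := by
  have hpos : 0 < reg.a k / reg.Zm k := div_pos (reg.a_pos k) (reg.Zm_pos k)
  have h1 : reg.a k * C / reg.Zm k = C * (reg.a k / reg.Zm k) := by ring
  have h2 : reg.a k * M / reg.Zm k = M * (reg.a k / reg.Zm k) := by ring
  rw [h1, h2]
  nlinarith [mul_pos (by linarith : 0 < C + M) hpos]

/-- `m_crit(k) − a_k (C+1)/Z_m(k) = (m_crit(k) − a_k C/Z_m(k)) − a_k/Z_m(k)`: one RGI unit below the negative heavy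
point. [folklore] -/
theorem ray_below_succ (reg : QCDRegularisation Nf) (C : ℝ) (k : ℕ) :
    reg.mcrit k - reg.a k * (C + 1) / reg.Zm k = (reg.mcrit k - reg.a k * C / reg.Zm k) - reg.a k / reg.Zm k := by
  ring

/-! ## §3 The abstract sign-flip locator gives R's conclusion for one regularisation -/

/-- **(b') SIGN-FLIP LOCATOR, dichotomy form ⇒ a non-massive point within RGI depth `C + 1` (one regularisation).**
Data: predicates `P Q : ℝ → ℝ → Prop` of (coupling, degenerate bare mass) and constants `β₀ C M`.  Hypotheses: the
fixed-coupling LOCATOR — at every `β ≥ β₀`, for `−1 < μ₁ < μ₂`, `P β μ₁` and `Q β μ₂` force `[μ₁, μ₂]` to meet the closure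
of the non-massive set at `β`; `β_k → +∞`; the branch `−1 < μ₁(k) := m_crit(k) − a_k C/Z_m(k)` eventually; `−C < M`;
eventually [`μ₁(k)` is itself non-massive at `β_k` OR `P (β_k) (μ₁(k))`]; eventually `Q (β_k) (μ₂(k))`,
`μ₂(k) := m_crit(k) + a_k M/Z_m(k)`.  Conclusion: eventually some non-massive `μ ≥ m_crit(k) − a_k(C+1)/Z_m(k)` — in the
first case `μ₁(k)` itself, in the second the closure point `μ⋆ ∈ [μ₁(k), μ₂(k)]` has a genuine non-massive mass above
`μ⋆ − a_k/Z_m(k) ≥ μ₁(k) − a_k/Z_m(k)` (`exists_mem_gt_of_mem_closure` with `ε := a_k/Z_m(k) > 0`).  With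
`P` := "PCAC ratio eventually negative", `Q` := "… positive" this is the card `Ideas/pcac-sign-flip.md` including its
`N_f = 3` dichotomy at the `θ_eff = π` point `μ₁(k)`; the physics is entirely in the hypotheses. [folklore] -/
theorem nonMassive_below_of_signFlipLocator_or_self :
    ∀ (Nf : ℕ) (reg : QCDRegularisation Nf) (P Q : ℝ → ℝ → Prop) (β₀ C M : ℝ),
      (∀ β : ℝ, β₀ ≤ β → ∀ μ₁ μ₂ : ℝ, -1 < μ₁ → μ₁ < μ₂ → P β μ₁ → Q β μ₂ →
        ∃ μ ∈ Set.Icc μ₁ μ₂, μ ∈ closure {μ : ℝ | ¬ (∀ (R R' : ℕ) (A : QCDLatticeObservable Nf R)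
          (B : QCDLatticeObservable Nf R'), ∃ (C δ : ℝ) (S₀ : ℕ), 0 < δ ∧ ∀ S : ℕ, S₀ ≤ S → ∀ n : ℕ, n ≤ S →
            ‖qcdLatticeConnectedCorr β (2 * S + 1) (fun _ : Fin Nf => μ) A B n‖ ≤ C * Real.exp (-(δ * n)))}) →
      Tendsto reg.β atTop atTop →
      (∀ᶠ k in atTop, -1 < reg.mcrit k - reg.a k * C / reg.Zm k) →
      -C < M →
      (∀ᶠ k in atTop,
        ¬ (∀ (R R' : ℕ) (A : QCDLatticeObservable Nf R) (B : QCDLatticeObservable Nf R'), ∃ (C' δ : ℝ) (S₀ : ℕ),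
          0 < δ ∧ ∀ S : ℕ, S₀ ≤ S → ∀ n : ℕ, n ≤ S →
            ‖qcdLatticeConnectedCorr (reg.β k) (2 * S + 1) (fun _ : Fin Nf => reg.mcrit k - reg.a k * C / reg.Zm k)
              A B n‖ ≤ C' * Real.exp (-(δ * n))) ∨
        P (reg.β k) (reg.mcrit k - reg.a k * C / reg.Zm k)) →
      (∀ᶠ k in atTop, Q (reg.β k) (reg.mcrit k + reg.a k * M / reg.Zm k)) →
      ∀ᶠ k in atTop, ∃ μ : ℝ, reg.mcrit k - reg.a k * (C + 1) / reg.Zm k ≤ μ ∧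
        ¬ (∀ (R R' : ℕ) (A : QCDLatticeObservable Nf R) (B : QCDLatticeObservable Nf R'), ∃ (C δ : ℝ) (S₀ : ℕ),
          0 < δ ∧ ∀ S : ℕ, S₀ ≤ S → ∀ n : ℕ, n ≤ S →
            ‖qcdLatticeConnectedCorr (reg.β k) (2 * S + 1) (fun _ : Fin Nf => μ) A B n‖ ≤ C * Real.exp (-(δ * n))) := by
  intro Nf reg P Q β₀ C M hL hβ hbr hCM hP hQ
  filter_upwards [hβ.eventually_ge_atTop β₀, hbr, hP, hQ] with k hk hbr₁ hP₁ hQ₂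
  have hpos : 0 < reg.a k / reg.Zm k := div_pos (reg.a_pos k) (reg.Zm_pos k)
  have hstep := ray_below_succ reg C k
  rcases hP₁ with hself | hP₁
  · -- the negative heavy point is itself non-massive
    exact ⟨reg.mcrit k - reg.a k * C / reg.Zm k, by rw [hstep]; linarith, hself⟩
  · -- the locator places a closure point in `[μ₁(k), μ₂(k)]`; step down by `a_k/Z_m(k)` to a genuine member
    obtain ⟨μs, ⟨h₁, -⟩, hcl⟩ :=
      hL (reg.β k) hk _ _ hbr₁ (ray_below_lt_ray_above reg C M hCM k) hP₁ hQ₂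
    obtain ⟨μ, hμN, hμgt⟩ := exists_mem_gt_of_mem_closure _ μs hcl _ hpos
    exact ⟨μ, by rw [hstep]; linarith, hμN⟩

/-- **(b) SIGN-FLIP LOCATOR ⇒ a non-massive point within RGI depth `C + 1` (one regularisation).**  As
`nonMassive_below_of_signFlipLocator_or_self` with the plain sign hypothesis "eventually `P (β_k) (μ₁(k))`" at the
negative heavy point `μ₁(k) = m_crit(k) − a_k C/Z_m(k)` (and `Q (β_k) (μ₂(k))` at `μ₂(k) = m_crit(k) + a_k M/Z_m(k)`):
eventually some NON-massive degenerate bare mass `μ ≥ m_crit(k) − a_k (C+1)/Z_m(k)` exists at `β_k` — R's conclusion for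
`reg` with constant `C + 1`.  The locator (card `Ideas/pcac-sign-flip.md`, `PCACSignFlipLocator` with the PCAC signs
abstracted to `P`, `Q`) and the two eventual signs are HYPOTHESES. [folklore] -/
theorem nonMassive_below_of_signFlipLocator :
    ∀ (Nf : ℕ) (reg : QCDRegularisation Nf) (P Q : ℝ → ℝ → Prop) (β₀ C M : ℝ),
      (∀ β : ℝ, β₀ ≤ β → ∀ μ₁ μ₂ : ℝ, -1 < μ₁ → μ₁ < μ₂ → P β μ₁ → Q β μ₂ →
        ∃ μ ∈ Set.Icc μ₁ μ₂, μ ∈ closure {μ : ℝ | ¬ (∀ (R R' : ℕ) (A : QCDLatticeObservable Nf R)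
          (B : QCDLatticeObservable Nf R'), ∃ (C δ : ℝ) (S₀ : ℕ), 0 < δ ∧ ∀ S : ℕ, S₀ ≤ S → ∀ n : ℕ, n ≤ S →
            ‖qcdLatticeConnectedCorr β (2 * S + 1) (fun _ : Fin Nf => μ) A B n‖ ≤ C * Real.exp (-(δ * n)))}) →
      Tendsto reg.β atTop atTop →
      (∀ᶠ k in atTop, -1 < reg.mcrit k - reg.a k * C / reg.Zm k) →
      -C < M →
      (∀ᶠ k in atTop, P (reg.β k) (reg.mcrit k - reg.a k * C / reg.Zm k)) →
      (∀ᶠ k in atTop, Q (reg.β k) (reg.mcrit k + reg.a k * M / reg.Zm k)) →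
      ∀ᶠ k in atTop, ∃ μ : ℝ, reg.mcrit k - reg.a k * (C + 1) / reg.Zm k ≤ μ ∧
        ¬ (∀ (R R' : ℕ) (A : QCDLatticeObservable Nf R) (B : QCDLatticeObservable Nf R'), ∃ (C δ : ℝ) (S₀ : ℕ),
          0 < δ ∧ ∀ S : ℕ, S₀ ≤ S → ∀ n : ℕ, n ≤ S →
            ‖qcdLatticeConnectedCorr (reg.β k) (2 * S + 1) (fun _ : Fin Nf => μ) A B n‖ ≤ C * Real.exp (-(δ * n))) := by
  intro Nf reg P Q β₀ C M hL hβ hbr hCM hP hQ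
  exact nonMassive_below_of_signFlipLocator_or_self Nf reg P Q β₀ C M hL hβ hbr hCM
    (hP.mono fun k hk => Or.inr hk) hQ

/-! ## §4 The registered statement of R from a sign-flip family (statement-level reductions) -/

/-- **(c') SIGN-FLIP FAMILY, dichotomy form ⇒ R (the registered statement of `stub_nonMassiveBelowOfBody`, verbatim).**
Hypothesis (OPEN physics, inlined): for each `N_f ∈ {2,3}` there are predicates `P Q : ℝ → ℝ → Prop` (intended: the
finite-torus PCAC ratio in a flavour-changing channel is eventually negative / positive) and `β₀` such that (i) the
fixed-coupling LOCATOR holds at every `β ≥ β₀` (a `P`-point `μ₁ > −1` below a `Q`-point `μ₂` forces `[μ₁, μ₂]` to meet the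
closure of the non-massive set), and (ii) every mass-scaling, asymptotically scaling regularisation carrying the heavy
body above `M` has constants `C`, `M₂` with: eventually `−1 < μ₁(k) := m_crit(k) − a_k C/Z_m(k)` (branch), `−C < M₂`,
eventually [`μ₁(k)` MASSIVE at `β_k` ⇒ `P (β_k) (μ₁(k))`] (the card's `UVSignDominance` dichotomy at the `θ_eff = π` point),
and eventually `Q (β_k) (m_crit(k) + a_k M₂/Z_m(k))`.  Conclusion: R with `C + 1`, by
`nonMassive_below_of_signFlipLocator_or_self` along `β_k → +∞`
(`QCDRegularisation.tendsto_beta_atTop_of_hasAsymptoticScaling`, `N_f ≤ 16`). [folklore] -/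
theorem stub_nonMassiveBelowOfBody_of_signFlipFamily_or_self :
    (∀ Nf : ℕ, Nf = 2 ∨ Nf = 3 → ∃ (P Q : ℝ → ℝ → Prop) (β₀ : ℝ),
      (∀ β : ℝ, β₀ ≤ β → ∀ μ₁ μ₂ : ℝ, -1 < μ₁ → μ₁ < μ₂ → P β μ₁ → Q β μ₂ →
        ∃ μ ∈ Set.Icc μ₁ μ₂, μ ∈ closure {μ : ℝ | ¬ (∀ (R R' : ℕ) (A : QCDLatticeObservable Nf R)
          (B : QCDLatticeObservable Nf R'), ∃ (C δ : ℝ) (S₀ : ℕ), 0 < δ ∧ ∀ S : ℕ, S₀ ≤ S → ∀ n : ℕ, n ≤ S →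
            ‖qcdLatticeConnectedCorr β (2 * S + 1) (fun _ : Fin Nf => μ) A B n‖ ≤ C * Real.exp (-(δ * n)))}) ∧
      ∀ (reg : QCDRegularisation Nf) (M : ℝ), reg.HasMassScaling → (reg.scheme 0 0 0).HasAsymptoticScaling →
        (∀ m : Fin Nf → ℝ, (∀ f, M < m f) → ∃ (z shift : QCDField Nf → ℕ → ℝ) (T : OSData (QCDField Nf) 4),
          IsQCDAlong (reg.scheme m z shift) T ∧ T.IsNontrivial QCDField.glue ∧ T.IsNonGaussian QCDField.glue ∧
            (∀ f g : Fin Nf, f ≠ g → T.IsNontrivial (QCDField.pseudoRe f g)) ∧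
              ∃ Δ > 0, T.HasMassGap Δ ∧ (reg.scheme m z shift).HasLatticeMassGap Δ) →
        ∃ C M₂ : ℝ, (∀ᶠ k in atTop, -1 < reg.mcrit k - reg.a k * C / reg.Zm k) ∧ -C < M₂ ∧
          (∀ᶠ k in atTop,
            (∀ (R R' : ℕ) (A : QCDLatticeObservable Nf R) (B : QCDLatticeObservable Nf R'), ∃ (C' δ : ℝ) (S₀ : ℕ),
              0 < δ ∧ ∀ S : ℕ, S₀ ≤ S → ∀ n : ℕ, n ≤ S →
                ‖qcdLatticeConnectedCorr (reg.β k) (2 * S + 1) (fun _ : Fin Nf => reg.mcrit k - reg.a k * C / reg.Zm k)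
                  A B n‖ ≤ C' * Real.exp (-(δ * n))) →
            P (reg.β k) (reg.mcrit k - reg.a k * C / reg.Zm k)) ∧
          (∀ᶠ k in atTop, Q (reg.β k) (reg.mcrit k + reg.a k * M₂ / reg.Zm k))) →
    ∀ Nf : ℕ, Nf = 2 ∨ Nf = 3 → ∀ (reg : QCDRegularisation Nf) (M : ℝ), reg.HasMassScaling →
    (reg.scheme 0 0 0).HasAsymptoticScaling →
    (∀ m : Fin Nf → ℝ, (∀ f, M < m f) → ∃ (z shift : QCDField Nf → ℕ → ℝ) (T : OSData (QCDField Nf) 4),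
    IsQCDAlong (reg.scheme m z shift) T ∧ T.IsNontrivial QCDField.glue ∧ T.IsNonGaussian QCDField.glue ∧
    (∀ f g : Fin Nf, f ≠ g → T.IsNontrivial (QCDField.pseudoRe f g)) ∧
    ∃ Δ > 0, T.HasMassGap Δ ∧ (reg.scheme m z shift).HasLatticeMassGap Δ) →
    ∃ C : ℝ, ∀ᶠ k in atTop, ∃ μ : ℝ, reg.mcrit k - reg.a k * C / reg.Zm k ≤ μ ∧
    ¬ (∀ (R R' : ℕ) (A : QCDLatticeObservable Nf R) (B : QCDLatticeObservable Nf R'), ∃ (C δ : ℝ) (S₀ : ℕ),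
    0 < δ ∧ ∀ S : ℕ, S₀ ≤ S → ∀ n : ℕ, n ≤ S →
    ‖qcdLatticeConnectedCorr (reg.β k) (2 * S + 1) (fun _ : Fin Nf => μ) A B n‖ ≤ C * Real.exp (-(δ * n))) := by
  intro hfam Nf hNf reg M hms haf hbody
  obtain ⟨P, Q, β₀, hL, hdata⟩ := hfam Nf hNf
  obtain ⟨C, M₂, hbr, hCM, hP, hQ⟩ := hdata reg M hms haf hbody
  have hNf16 : Nf ≤ 16 := by rcases hNf with rfl | rfl <;> norm_num
  have hβ : Tendsto reg.β atTop atTop :=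
    QCDRegularisation.tendsto_beta_atTop_of_hasAsymptoticScaling hNf16 reg 0 0 0 haf
  exact ⟨C + 1, nonMassive_below_of_signFlipLocator_or_self Nf reg P Q β₀ C M₂ hL hβ hbr hCM
    (hP.mono fun k hk => imp_iff_not_or.1 hk) hQ⟩

/-- **(c) SIGN-FLIP FAMILY ⇒ R (the registered statement of `stub_nonMassiveBelowOfBody`, verbatim).**  Hypothesis
(OPEN physics, inlined; the supplier proposed by card `Ideas/pcac-sign-flip.md`): for each `N_f ∈ {2,3}` there are
predicates `P Q : ℝ → ℝ → Prop` (intended: PCAC ratio eventually negative / positive) and `β₀` such that (i) the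
fixed-coupling sign-flip LOCATOR holds at every `β ≥ β₀`, and (ii) every mass-scaling, asymptotically scaling
regularisation carrying the heavy body above `M` has constants `C`, `M₂` with the branch `−1 < m_crit(k) − a_k C/Z_m(k)`
eventually, `−C < M₂`, and the two eventual signs `P (β_k) (m_crit(k) − a_k C/Z_m(k))`, `Q (β_k) (m_crit(k) + a_k M₂/Z_m(k))`
at the construction's own heavy points.  Conclusion: R with `C + 1` (special case of
`stub_nonMassiveBelowOfBody_of_signFlipFamily_or_self`). [folklore] -/
theorem stub_nonMassiveBelowOfBody_of_signFlipFamily :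
    (∀ Nf : ℕ, Nf = 2 ∨ Nf = 3 → ∃ (P Q : ℝ → ℝ → Prop) (β₀ : ℝ),
      (∀ β : ℝ, β₀ ≤ β → ∀ μ₁ μ₂ : ℝ, -1 < μ₁ → μ₁ < μ₂ → P β μ₁ → Q β μ₂ →
        ∃ μ ∈ Set.Icc μ₁ μ₂, μ ∈ closure {μ : ℝ | ¬ (∀ (R R' : ℕ) (A : QCDLatticeObservable Nf R)
          (B : QCDLatticeObservable Nf R'), ∃ (C δ : ℝ) (S₀ : ℕ), 0 < δ ∧ ∀ S : ℕ, S₀ ≤ S → ∀ n : ℕ, n ≤ S →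
            ‖qcdLatticeConnectedCorr β (2 * S + 1) (fun _ : Fin Nf => μ) A B n‖ ≤ C * Real.exp (-(δ * n)))}) ∧
      ∀ (reg : QCDRegularisation Nf) (M : ℝ), reg.HasMassScaling → (reg.scheme 0 0 0).HasAsymptoticScaling →
        (∀ m : Fin Nf → ℝ, (∀ f, M < m f) → ∃ (z shift : QCDField Nf → ℕ → ℝ) (T : OSData (QCDField Nf) 4),
          IsQCDAlong (reg.scheme m z shift) T ∧ T.IsNontrivial QCDField.glue ∧ T.IsNonGaussian QCDField.glue ∧
            (∀ f g : Fin Nf, f ≠ g → T.IsNontrivial (QCDField.pseudoRe f g)) ∧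
              ∃ Δ > 0, T.HasMassGap Δ ∧ (reg.scheme m z shift).HasLatticeMassGap Δ) →
        ∃ C M₂ : ℝ, (∀ᶠ k in atTop, -1 < reg.mcrit k - reg.a k * C / reg.Zm k) ∧ -C < M₂ ∧
          (∀ᶠ k in atTop, P (reg.β k) (reg.mcrit k - reg.a k * C / reg.Zm k)) ∧
          (∀ᶠ k in atTop, Q (reg.β k) (reg.mcrit k + reg.a k * M₂ / reg.Zm k))) →
    ∀ Nf : ℕ, Nf = 2 ∨ Nf = 3 → ∀ (reg : QCDRegularisation Nf) (M : ℝ), reg.HasMassScaling →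
    (reg.scheme 0 0 0).HasAsymptoticScaling →
    (∀ m : Fin Nf → ℝ, (∀ f, M < m f) → ∃ (z shift : QCDField Nf → ℕ → ℝ) (T : OSData (QCDField Nf) 4),
    IsQCDAlong (reg.scheme m z shift) T ∧ T.IsNontrivial QCDField.glue ∧ T.IsNonGaussian QCDField.glue ∧
    (∀ f g : Fin Nf, f ≠ g → T.IsNontrivial (QCDField.pseudoRe f g)) ∧
    ∃ Δ > 0, T.HasMassGap Δ ∧ (reg.scheme m z shift).HasLatticeMassGap Δ) →
    ∃ C : ℝ, ∀ᶠ k in atTop, ∃ μ : ℝ, reg.mcrit k - reg.a k * C / reg.Zm k ≤ μ ∧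
    ¬ (∀ (R R' : ℕ) (A : QCDLatticeObservable Nf R) (B : QCDLatticeObservable Nf R'), ∃ (C δ : ℝ) (S₀ : ℕ),
    0 < δ ∧ ∀ S : ℕ, S₀ ≤ S → ∀ n : ℕ, n ≤ S →
    ‖qcdLatticeConnectedCorr (reg.β k) (2 * S + 1) (fun _ : Fin Nf => μ) A B n‖ ≤ C * Real.exp (-(δ * n))) := by
  intro hfam Nf hNf reg M hms haf hbody
  obtain ⟨P, Q, β₀, hL, hdata⟩ := hfam Nf hNf
  obtain ⟨C, M₂, hbr, hCM, hP, hQ⟩ := hdata reg M hms haf hbody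
  have hNf16 : Nf ≤ 16 := by rcases hNf with rfl | rfl <;> norm_num
  have hβ : Tendsto reg.β atTop atTop :=
    QCDRegularisation.tendsto_beta_atTop_of_hasAsymptoticScaling hNf16 reg 0 0 0 haf
  exact ⟨C + 1, nonMassive_below_of_signFlipLocator Nf reg P Q β₀ C M₂ hL hβ hbr hCM hP hQ⟩

end Summit.QuantumFields.QCD.Theorems.HonestHeavyAnchorNonMassiveBelowSignFlip
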